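import Literature.MathematicalPhysics.KineticTheory.LangevinChainHarris

/-!
# Harris' theorem for the pinned chain with constants UNIFORM in the bath temperatures
(helper for stub S2a `stub_uniformAsymmetryTransfer`, line `fekete-usc-one-length`)

`--supports stmt-AtomisticToContinuum-11976` helper file (crux `VanishingNoiseBound`, route
`VanishingNoiseTransfer`). The exponential convergence (CEHR 2018 (2.5))
`|P_t f(z) - μ⋆(f)| ≤ C e^{θH(z)} e^{-ct}` of the flip-free transition semigroup of
`pinnedChain ω₂ lam β γ` is proved in the tree (`pinnedChainSemigroup_exp_convergence`,
`LangevinChainHarris.lean`) with `C, c` EXISTENTIAL per pair of temperatures: Harris' theorem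
(Hairer–Mattingly) is fed the H2 drift constants at `t⋆ = 1` and the minorisation time and weight
on the sublevel set `{e^{θH} ≤ R}`, all obtained per `(T_L, T_R)`. The constants of Hairer–Mattingly
themselves are EXPLICIT (`Harris.abs_integral_sub_integral_le`: `β = α/(2(K+1))`,
`ᾱ = (1-α/2) ∨ γ ∨ (2+βR(γ+2K/R))/(2+βR)`), and so are those of the passage to continuous time
((3.4): `P_s e^{θH} ≤ e^{θγ(T_L+T_R)s} e^{θH}`). This file isolates that bookkeeping:

* `expConvergence_of_drift_of_minorization` — for weight `θ`, drift constants `(a, b)` at time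
  `1`, a minorisation weight `α` at an integer time `m` on `{e^{θH} ≤ (2b/(1-a)+1)/(1-a)}` and a
  bound `Λ ≥ θγ(T_L+T_R)`, there are `C, c > 0` depending ONLY on `(a, b, α, m, Λ)` such that for
  EVERY pair of temperatures at which the transition kernels satisfy that drift and that
  minorisation, every invariant probability measure `μ` obeys (2.5) with `(C, c)`.

Hence temperature-uniform (2.5) near equilibrium — input (UEC) of
`uniformAsymmetryTransfer_of_uniformExpConvergence` — reduces to temperature-uniform H2 and
minorisation constants. No definitions.
-/

noncomputable section

namespace Summit.AtomisticToContinuum.FouriersLaw.Theorems.FixedLengthNoiseContinuity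

open MeasureTheory ProbabilityTheory Filter Topology Set
open scoped NNReal ENNReal BoundedContinuousFunction
open Literature.MathematicalPhysics.KineticTheory.HeatConduction
open Literature.Probability.Process

variable {ω₂ lam β γ : ℝ} {N : ℕ}

/-- **(2.5) with constants depending only on the drift and minorisation constants.** Let
`ω₂, β, γ > 0`, `lam ≥ 0`, `N ≥ 1`, a weight `θ > 0`, drift constants `0 ≤ a < 1`, `b ≥ 0`, a
minorisation weight `α > 0` at an integer time `m ≥ 1`, and `Λ ≥ 0`. There are `C, c > 0` such that
for all `T_L, T_R > 0` with `θ < 1/max(T_L,T_R)` and `θγ(T_L+T_R) ≤ Λ`: if the transition kernels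
of `pinnedChain ω₂ lam β γ` satisfy the drift `P_1 e^{θH} ≤ a e^{θH} + b` and the minorisation
`P_m(z,·) ≥ α ν` (`ν` a probability measure) on `{e^{θH} ≤ (2b/(1-a)+1)/(1-a)}`, then every
invariant probability measure `μ` satisfies `|P_t f(z) - μ(f)| ≤ C e^{θH(z)} e^{-ct}` for all
`z`, `t ≥ 0`, continuous `|f| ≤ e^{θH}`. Proof: `pinnedChainSemigroup_harris` and
`pinnedChainSemigroup_exp_convergence` (`LangevinChainHarris.lean`) re-run with Hairer–Mattingly's
explicit contraction (`Harris.abs_integral_sub_integral_le`, `β = α/(2(B+1))`, `B = b/(1-a)`,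
`R = (2B+1)/(1-a)`, skeleton `P_m`, drift `P_m V ≤ aᵐ V + B`), the moment bound
`μ(V) ≤ B/(1-aᵐ)` (`Harris.lintegral_le_of_invariant`) and (3.4) bounded through `Λ`:
`C = C₁ e^{Λm}/ᾱ`, `c = -log ᾱ/m`, `C₁ = β⁻¹(2 + βB/(1-aᵐ)) + 1`. -/
theorem expConvergence_of_drift_of_minorization (hω : 0 < ω₂) (hl : 0 ≤ lam) (hβ : 0 < β)
    (hγ : 0 < γ) (hN : 0 < N) {θ : ℝ} (hθ : 0 < θ) {a b α : ℝ} (ha0 : 0 ≤ a) (ha1 : a < 1)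
    (hb : 0 ≤ b) (hα : 0 < α) {m : ℕ} (hm : 0 < m) {Λ : ℝ} (hΛ : 0 ≤ Λ) :
    ∃ C c : ℝ, 0 < C ∧ 0 < c ∧ ∀ T_L T_R : ℝ, 0 < T_L → 0 < T_R → θ < 1 / max T_L T_R →
      θ * γ * (T_L + T_R) ≤ Λ →
      (∀ z : PhaseSpace N,
        ∫⁻ y, ENNReal.ofReal (Real.exp (θ * (pinnedChain ω₂ lam β γ).hamiltonian N y))
            ∂((pinnedChain ω₂ lam β γ).transitionKernel N T_L T_R 1 z) ≤
          ENNReal.ofReal a * ENNReal.ofReal (Real.exp (θ * (pinnedChain ω₂ lam β γ).hamiltonian N z)) +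
            ENNReal.ofReal b) →
      (∃ ν : Measure (PhaseSpace N), IsProbabilityMeasure ν ∧ ∀ z : PhaseSpace N,
        Real.exp (θ * (pinnedChain ω₂ lam β γ).hamiltonian N z) ≤ (2 * (b / (1 - a)) + 1) / (1 - a) →
          ENNReal.ofReal α • ν ≤ (pinnedChain ω₂ lam β γ).transitionKernel N T_L T_R (m : ℝ≥0) z) →
      ∀ μ : Measure (PhaseSpace N), IsProbabilityMeasure μ →
        (∀ t : ℝ≥0, μ.bind ((pinnedChain ω₂ lam β γ).transitionKernel N T_L T_R t) = μ) →
        ∀ (z : PhaseSpace N) (t : ℝ≥0) (f : PhaseSpace N → ℝ), Continuous f →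
          (∀ y, |f y| ≤ Real.exp (θ * (pinnedChain ω₂ lam β γ).hamiltonian N y)) →
          |∫ y, f y ∂((pinnedChain ω₂ lam β γ).transitionKernel N T_L T_R t z) - ∫ y, f y ∂μ| ≤
            C * Real.exp (θ * (pinnedChain ω₂ lam β γ).hamiltonian N z) * Real.exp (-c * t) := by
  -- adapted from `pinnedChainSemigroup_harris` and `pinnedChainSemigroup_exp_convergence`
  -- (Literature/…/LangevinChainHarris.lean), with Hairer–Mattingly's explicit constants
  ------------------------------------------------------------------
  -- Step 0: the temperature-free constants
  ------------------------------------------------------------------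
  set aN : ℝ≥0 := a.toNNReal with haN
  set bN : ℝ≥0 := b.toNNReal with hbN
  set αN : ℝ≥0 := α.toNNReal with hαN
  have haNr : (aN : ℝ) = a := Real.coe_toNNReal _ ha0
  have hbNr : (bN : ℝ) = b := Real.coe_toNNReal _ hb
  have hαNr : (αN : ℝ) = α := Real.coe_toNNReal _ hα.le
  have haN1 : aN < 1 := by rw [← NNReal.coe_lt_coe, haNr, NNReal.coe_one]; exact ha1
  have h1a : 0 < 1 - aN := tsub_pos_of_lt haN1
  set B : ℝ≥0 := bN / (1 - aN) with hB
  set R : ℝ≥0 := (2 * B + 1) / (1 - aN) with hRdef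
  have hRa : (1 - aN) * R = 2 * B + 1 := by rw [hRdef, mul_comm, div_mul_cancel₀ _ h1a.ne']
  have hBr : (B : ℝ) = b / (1 - a) := by rw [hB, NNReal.coe_div, NNReal.coe_sub haN1.le]; simp [haNr, hbNr]
  have hRr : (R : ℝ) = (2 * (b / (1 - a)) + 1) / (1 - a) := by
    rw [hRdef, NNReal.coe_div, NNReal.coe_sub haN1.le]; push_cast; rw [hBr, haNr]
  have hm0 : m ≠ 0 := by omega
  set γm : ℝ≥0 := aN ^ m with hγm
  have hγ1 : γm < 1 := pow_lt_one₀ zero_le haN1 hm0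
  have hγa : γm ≤ aN := pow_le_of_le_one zero_le haN1.le hm0
  have hRcond : 2 * B < (1 - γm) * R := by
    calc 2 * B < 2 * B + 1 := lt_add_one _
      _ = (1 - aN) * R := hRa.symm
      _ ≤ (1 - γm) * R := mul_le_mul_of_nonneg_right (tsub_le_tsub_left hγa 1) zero_le
  -- Hairer–Mattingly: `α₀ = α/2`, `β = α/(2(B+1))`, contraction factor `ᾱ`
  set βh : ℝ := α / (2 * (B + 1)) with hβh
  have hB0 : (0 : ℝ) ≤ B := B.coe_nonneg
  have hβh0 : 0 < βh := by positivity
  have hβK : βh * B ≤ αN / 2 := by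
    rw [hαNr, hβh, div_mul_eq_mul_div, div_le_div_iff₀ (by positivity) (by positivity)]
    nlinarith [hα.le]
  have hα₀α : (αN : ℝ) / 2 < αN := by rw [hαNr]; linarith
  set abar : ℝ := max (max (1 - αN + αN / 2) γm) ((2 + βh * R * (γm + 2 * B / R)) / (2 + βh * R))
    with habar
  have ha0' : 0 < abar := Harris.contractionFactor_pos hβh0
  have ha1' : abar < 1 := Harris.contractionFactor_lt_one hγ1 hRcond hα₀α hβh0
  -- the moment bound and the constants of (2.5)
  set mV : ℝ := ((B / (1 - γm) : ℝ≥0) : ℝ) with hmV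
  have hmV0 : 0 ≤ mV := NNReal.coe_nonneg _
  set C₁ : ℝ := βh⁻¹ * (2 + βh * mV) + 1 with hC₁def
  have hC₁ : 0 < C₁ := by rw [hC₁def]; positivity
  set t₀ : ℝ≥0 := (m : ℝ≥0) with ht₀def
  have ht₀ : 0 < t₀ := by rw [ht₀def]; exact_mod_cast hm
  have ht₀r : (0 : ℝ) < t₀ := by exact_mod_cast ht₀
  have ht₀m : ((t₀ : ℝ≥0) : ℝ) = m := by rw [ht₀def]; push_cast; rfl
  set c : ℝ := -Real.log abar / t₀ with hcdef
  have hlog : Real.log abar < 0 := Real.log_neg ha0' ha1'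
  have hc : 0 < c := by rw [hcdef]; exact div_pos (by linarith) ht₀r
  refine ⟨C₁ * Real.exp (Λ * t₀) / abar, c, div_pos (mul_pos hC₁ (Real.exp_pos _)) ha0', hc, ?_⟩
  ------------------------------------------------------------------
  -- Step 1: Harris for the skeleton `P_m` at the given temperatures
  ------------------------------------------------------------------
  intro T_L T_R hL hR hθ1 hΛT hdrift hmin μ hμ hinv z t f hf hfV
  set S := pinnedChainSemigroup hω hl hβ.le hγ.le hN hL.le hR.le with hS
  set Hm := (pinnedChain ω₂ lam β γ).hamiltonian N with hHm
  set V : PhaseSpace N → ℝ≥0 := fun z => (Real.exp (θ * Hm z)).toNNReal with hVdef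
  have hVc : Continuous V := continuous_real_toNNReal.comp (Real.continuous_exp.comp
    (continuous_const.mul (pinnedChain_continuous_hamiltonian ω₂ lam β γ N)))
  have hV : Measurable V := hVc.measurable
  have hVcoe : ∀ z, (V z : ℝ≥0∞) = ENNReal.ofReal (Real.exp (θ * Hm z)) := fun z => rfl
  have hVreal : ∀ z, (V z : ℝ) = Real.exp (θ * Hm z) := fun z =>
    Real.coe_toNNReal _ (Real.exp_pos _).le
  have hV1 : ∀ z, 1 ≤ Real.exp (θ * Hm z) := fun z =>
    Real.one_le_exp (mul_nonneg hθ.le (pinnedChain_hamiltonian_nonneg hω.le hl hβ.le γ N z))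
  -- the drift at time `1`
  have hdrift1 : ∀ z, ∫⁻ y, V y ∂(S.kernel 1 z) ≤ (aN : ℝ≥0∞) * V z + bN := fun z => hdrift z
  -- the skeleton kernel `P = P_m = P₁ᵐ` and its drift
  set P : Kernel (PhaseSpace N) (PhaseSpace N) := S.kernel t₀ with hPdef
  have hPpow : P = S.kernel 1 ^ m := by rw [hPdef, ht₀def, ← S.kernel_nat_mul 1 m, mul_one]
  haveI : IsMarkovKernel P := S.isMarkovKernel _
  have hdriftP : ∀ z, ∫⁻ y, V y ∂(P z) ≤ ((γm : ℝ≥0) : ℝ≥0∞) * V z + B := by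
    intro z
    rw [hPpow, hγm, ENNReal.coe_pow]
    exact Harris.lintegral_pow_le_of_drift (S.kernel 1) hV haN1 hdrift1 m z
  -- the minorisation on `{V ≤ R}`
  obtain ⟨ν, hν, hνmin⟩ := hmin
  haveI := hν
  have hminor : ∀ x, V x ≤ R → αN • ν ≤ P x := by
    intro x hx
    have hx' : Real.exp (θ * Hm x) ≤ (2 * (b / (1 - a)) + 1) / (1 - a) := by
      rw [← hVreal, ← hRr]; exact_mod_cast hx
    have h := hνmin x hx'
    rwa [ENNReal.smul_def] 
  -- the contraction of the `d_β`-seminorm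
  have hcontr : ∀ (φ : PhaseSpace N → ℝ), Measurable φ → ∀ M : ℝ, 0 ≤ M →
      (∀ x y, |φ x - φ y| ≤ M * (2 + βh * V x + βh * V y)) →
      ∀ x y, |∫ w, φ w ∂(P x) - ∫ w, φ w ∂(P y)| ≤ abar * M * (2 + βh * V x + βh * V y) :=
    fun φ hφm M hM hφ x y =>
      Harris.abs_integral_sub_integral_le P hV hγ1 hdriftP hRcond hminor hβh0 hβK hφm hM hφ x y
  -- the invariant measure: skeleton invariance, moment bound, geometric convergence
  haveI := hμ
  have hinvP : Kernel.Invariant P μ := hinv t₀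
  have hμVle : ∫⁻ w, (V w : ℝ≥0∞) ∂μ ≤ ((B / (1 - γm) : ℝ≥0) : ℝ≥0∞) :=
    Harris.lintegral_le_of_invariant P hV hγ1 hdriftP hinvP
  have hμV : ∫⁻ w, (V w : ℝ≥0∞) ∂μ ≠ ∞ := ne_top_of_le_ne_top ENNReal.coe_ne_top hμVle
  have hμVr : (∫⁻ w, (V w : ℝ≥0∞) ∂μ).toReal ≤ mV := by
    rw [hmV]
    exact ENNReal.toReal_le_coe_of_le_coe hμVle
  have hgeo : ∀ (n : ℕ) (φ : PhaseSpace N → ℝ), Measurable φ →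
      (∀ x, |φ x| ≤ 1 + βh * V x) →
      ∀ x, |∫ w, φ w ∂((P ^ n) x) - ∫ w, φ w ∂μ| ≤
        abar ^ n * (2 + βh * V x + βh * (∫⁻ w, (V w : ℝ≥0∞) ∂μ).toReal) := by
    intro n φ hφm hφ x
    have hLip : ∀ x y, |φ x - φ y| ≤ (1 : ℝ) * (2 + βh * V x + βh * V y) := by
      intro x y
      have := abs_sub (φ x) (φ y)
      linarith [hφ x, hφ y]
    simpa using Harris.abs_integral_pow_sub_integral_le P hV hγ1 hdriftP hcontr ha0'.le hinvP n hφm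
      zero_le_one hLip x
  ------------------------------------------------------------------
  -- Step 2: the continuous-time bound (proof of `pinnedChainSemigroup_exp_convergence`)
  ------------------------------------------------------------------
  -- (3.4), bounded through `Λ`
  have h34 : ∀ (s : ℝ≥0) (x : PhaseSpace N), ∫⁻ y, (V y : ℝ≥0∞) ∂(S.kernel s x) ≤
      ENNReal.ofReal (Real.exp (Λ * s) * Real.exp (θ * Hm x)) := by
    intro s x
    refine (lintegral_exp_mul_hamiltonian_pinnedChainSemigroup_le hω hl hβ.le hγ.le hN hL.le hR.le hL hR
      hθ hθ1 s x).trans (ENNReal.ofReal_le_ofReal ?_)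
    exact mul_le_mul_of_nonneg_right (Real.exp_le_exp.2
      (mul_le_mul_of_nonneg_right hΛT s.coe_nonneg)) (Real.exp_pos _).le
  have h34' : ∀ (s : ℝ≥0) (x : PhaseSpace N), ∫⁻ y, (V y : ℝ≥0∞) ∂(S.kernel s x) ≠ ∞ :=
    fun s x => ne_top_of_le_ne_top ENNReal.ofReal_ne_top (h34 s x)
  have hfm : Measurable f := hf.measurable
  have hfV' : ∀ y, |f y| ≤ 0 + 1 * V y := fun y => by rw [hVreal, zero_add, one_mul]; exact hfV y
  have hfint : ∀ (s : ℝ≥0) (x : PhaseSpace N), Integrable f (S.kernel s x) := fun s x =>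
    Harris.integrable_of_abs_le_affine hV (h34' s x) hfm hfV'
  -- Harris on the skeleton: `|Pⁿ f(x) - μ(f)| ≤ ᾱⁿ C₁ e^{θH(x)}`
  have hskel : ∀ (n : ℕ) (x : PhaseSpace N),
      |∫ y, f y ∂((P ^ n) x) - ∫ y, f y ∂μ| ≤ abar ^ n * C₁ * Real.exp (θ * Hm x) := by
    intro n x
    have hφm : Measurable fun y => βh * f y := hfm.const_mul βh
    have hφ' : ∀ y, |βh * f y| ≤ 1 + βh * V y := fun y => by
      rw [hVreal, abs_mul, abs_of_pos hβh0]
      have := mul_le_mul_of_nonneg_left (hfV y) hβh0.le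
      linarith
    have h := hgeo n (fun y => βh * f y) hφm hφ' x
    rw [integral_const_mul, integral_const_mul, ← mul_sub, abs_mul, abs_of_pos hβh0, hVreal] at h
    -- `h : βh |D| ≤ ᾱⁿ (2 + βh E + βh μ(V))`; compare with `βh ᾱⁿ C₁ E = ᾱⁿ (2E + βh mV E + βh E)`
    set E : ℝ := Real.exp (θ * Hm x) with hEdef
    set M' : ℝ := (∫⁻ w, (V w : ℝ≥0∞) ∂μ).toReal with hM'def
    have hE := hV1 x
    have hpow0 : 0 ≤ abar ^ n := pow_nonneg ha0'.le n
    have p1 : βh * M' ≤ βh * mV := mul_le_mul_of_nonneg_left hμVr hβh0.le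
    have p2 : βh * mV * 1 ≤ βh * mV * E := mul_le_mul_of_nonneg_left hE (mul_nonneg hβh0.le hmV0)
    have h3 : 2 + βh * E + βh * M' ≤ βh * (C₁ * E) := by
      have e1 : βh * (C₁ * E) = 2 * E + βh * mV * E + βh * E := by
        rw [hC₁def]; field_simp
      rw [e1]; linarith only [p1, p2, hE]
    have h4 : βh * |∫ y, f y ∂((P ^ n) x) - ∫ y, f y ∂μ| ≤ βh * (abar ^ n * C₁ * E) :=
      h.trans (by
        calc abar ^ n * (2 + βh * E + βh * M') ≤ abar ^ n * (βh * (C₁ * E)) :=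
              mul_le_mul_of_nonneg_left h3 hpow0
          _ = βh * (abar ^ n * C₁ * E) := by ring)
    exact le_of_mul_le_mul_left h4 hβh0
  -- `t = r + n t₀`, `r < t₀`
  obtain ⟨n, r, hr, rfl⟩ := exists_eq_add_nat_mul_of_pos ht₀ t
  -- the Markov property: `P_t f(z) = ∫ Pⁿ f(y) P_r(z, dy)`
  set g : PhaseSpace N → ℝ := fun y => ∫ w, f w ∂((P ^ n) y) with hg
  have hgm : Measurable g := (hfm.stronglyMeasurable.integral_kernel (κ := P ^ n)).measurable
  have hact : ∫ y, f y ∂((pinnedChain ω₂ lam β γ).transitionKernel N T_L T_R (r + n * t₀) z) =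
      ∫ y, g y ∂(S.kernel r z) := by
    have hint : Integrable f (((P ^ n) ∘ₖ S.kernel r) z) := by
      have := hfint (r + n * t₀) z
      rwa [S.kernel_add, S.kernel_nat_mul] at this
    change ∫ y, f y ∂(S.kernel (r + n * t₀) z) = _
    rw [S.kernel_add, S.kernel_nat_mul, ← hPdef]
    rw [Kernel.comp_apply] at hint ⊢
    exact Harris.integral_comp_measure (P ^ n) (S.kernel r z) hint
  rw [hact]
  -- integrate the skeleton bound against `P_r(z, ·)`
  have hgb : ∀ y, |g y - ∫ w, f w ∂μ| ≤ abar ^ n * C₁ * Real.exp (θ * Hm y) := fun y => hskel n y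
  have hgi : Integrable g (S.kernel r z) := by
    refine Harris.integrable_of_abs_le_affine hV (h34' r z) hgm (A := |∫ w, f w ∂μ|)
      (B := abar ^ n * C₁) fun y => ?_
    have h1 := hgb y
    rw [hVreal]
    have h2 : |g y| ≤ |∫ w, f w ∂μ| + |g y - ∫ w, f w ∂μ| := by
      have := abs_add_le (∫ w, f w ∂μ) (g y - ∫ w, f w ∂μ); rwa [add_sub_cancel] at this
    linarith
  have hVi : Integrable (fun y => (V y : ℝ)) (S.kernel r z) :=
    Harris.integrable_coe_of_lintegral_ne_top hV (h34' r z)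
  have hsub : (∫ y, g y ∂(S.kernel r z)) - ∫ w, f w ∂μ =
      ∫ y, (g y - ∫ w, f w ∂μ) ∂(S.kernel r z) := by
    rw [integral_sub hgi (integrable_const _), integral_const, probReal_univ, one_smul]
  have hPr : (∫⁻ y, (V y : ℝ≥0∞) ∂(S.kernel r z)).toReal ≤
      Real.exp (Λ * t₀) * Real.exp (θ * Hm z) := by
    refine (ENNReal.toReal_le_of_le_ofReal (by positivity) (h34 r z)).trans ?_
    refine mul_le_mul_of_nonneg_right (Real.exp_le_exp.2 ?_) (Real.exp_pos _).le
    exact mul_le_mul_of_nonneg_left (by exact_mod_cast hr.le) hΛ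
  -- `ᾱⁿ ≤ ᾱ⁻¹ e^{-ct}`
  have hpow : abar ^ n ≤ abar⁻¹ * Real.exp (-c * ((r + n * t₀ : ℝ≥0) : ℝ)) := by
    have hlogeq : Real.log abar = -c * t₀ := by
      rw [hcdef, neg_mul, div_mul_cancel₀ _ ht₀r.ne', neg_neg]
    have hn : abar ^ n = Real.exp (n * Real.log abar) := by
      rw [Real.exp_nat_mul, Real.exp_log ha0']
    have hinv' : abar⁻¹ = Real.exp (c * t₀) := by
      have : Real.exp (c * t₀) = Real.exp (-Real.log abar) := by
        rw [hlogeq]; simp only [neg_mul, neg_neg]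
      rw [this, Real.exp_neg, Real.exp_log ha0']
    rw [hn, hinv', ← Real.exp_add]
    refine Real.exp_le_exp.2 ?_
    rw [hlogeq]
    push_cast
    have hr' : ((r : ℝ≥0) : ℝ) ≤ t₀ := by exact_mod_cast hr.le
    have hc0 : 0 ≤ c := hc.le
    nlinarith [mul_nonneg hc0 (sub_nonneg.2 hr')]
  calc |(∫ y, g y ∂(S.kernel r z)) - ∫ w, f w ∂μ|
      = |∫ y, (g y - ∫ w, f w ∂μ) ∂(S.kernel r z)| := by rw [hsub]
    _ ≤ ∫ y, |g y - ∫ w, f w ∂μ| ∂(S.kernel r z) := abs_integral_le_integral_abs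
    _ ≤ ∫ y, abar ^ n * C₁ * (V y : ℝ) ∂(S.kernel r z) := by
        refine integral_mono (hgi.sub (integrable_const _)).abs (hVi.const_mul _) fun y => ?_
        have := hgb y
        rwa [← hVreal] at this
    _ = abar ^ n * C₁ * (∫⁻ y, (V y : ℝ≥0∞) ∂(S.kernel r z)).toReal := by
        rw [integral_const_mul, Harris.integral_coe_eq_toReal hV]
    _ ≤ abar ^ n * C₁ * (Real.exp (Λ * t₀) * Real.exp (θ * Hm z)) :=
        mul_le_mul_of_nonneg_left hPr (mul_nonneg (pow_nonneg ha0'.le n) hC₁.le)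
    _ ≤ (abar⁻¹ * Real.exp (-c * ((r + n * t₀ : ℝ≥0) : ℝ))) * C₁ *
          (Real.exp (Λ * t₀) * Real.exp (θ * Hm z)) :=
        mul_le_mul_of_nonneg_right (mul_le_mul_of_nonneg_right hpow hC₁.le) (by positivity)
    _ = C₁ * Real.exp (Λ * t₀) / abar * Real.exp (θ * Hm z) *
          Real.exp (-c * ((r + n * t₀ : ℝ≥0) : ℝ)) := by
        ring


/-- Registered helper sub-goal `helper_uniformHarris` of stmt-AtomisticToContinuum-11976
(= `expConvergence_of_drift_of_minorization`, fully quantified, notation-free one-line form):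
CEHR (2.5) for the pinned chain with constants depending only on the drift and minorisation
constants, hence uniform in the bath temperatures. -/
theorem helper_uniformHarris : ∀ (ω₂ lam β γ : ℝ), 0 < ω₂ → 0 ≤ lam → 0 < β → 0 < γ → ∀ (N : ℕ), 0 < N → ∀ (θ : ℝ), 0 < θ → ∀ (a b α : ℝ), 0 ≤ a → a < 1 → 0 ≤ b → 0 < α → ∀ (m : ℕ), 0 < m → ∀ (Λ : ℝ), 0 ≤ Λ → ∃ C c : ℝ, 0 < C ∧ 0 < c ∧ ∀ T_L T_R : ℝ, 0 < T_L → 0 < T_R → θ < 1 / max T_L T_R → θ * γ * (T_L + T_R) ≤ Λ → (∀ z : Literature.MathematicalPhysics.KineticTheory.HeatConduction.PhaseSpace N, MeasureTheory.lintegral ((Literature.MathematicalPhysics.KineticTheory.HeatConduction.pinnedChain ω₂ lam β γ).transitionKernel N T_L T_R 1 z) (fun y => ENNReal.ofReal (Real.exp (θ * (Literature.MathematicalPhysics.KineticTheory.HeatConduction.pinnedChain ω₂ lam β γ).hamiltonian N y))) ≤ ENNReal.ofReal a * ENNReal.ofReal (Real.exp (θ * (Literature.MathematicalPhysics.KineticTheory.HeatConduction.pinnedChain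 ω₂ lam β γ).hamiltonian N z)) + ENNReal.ofReal b) → (∃ ν : MeasureTheory.Measure (Literature.MathematicalPhysics.KineticTheory.HeatConduction.PhaseSpace N), MeasureTheory.IsProbabilityMeasure ν ∧ ∀ z : Literature.MathematicalPhysics.KineticTheory.HeatConduction.PhaseSpace N, Real.exp (θ * (Literature.MathematicalPhysics.KineticTheory.HeatConduction.pinnedChain ω₂ lam β γ).hamiltonian N z) ≤ (2 * (b / (1 - a)) + 1) / (1 - a) → ENNReal.ofReal α • ν ≤ (Literature.MathematicalPhysics.KineticTheory.HeatConduction.pinnedChain ω₂ lam β γ).transitionKernel N T_L T_R (m : NNReal) z) → ∀ μ : MeasureTheory.Measure (Literature.MathematicalPhysics.KineticTheory.HeatConduction.PhaseSpace N), MeasureTheory.IsProbabilityMeasure μ → (∀ t : NNReal, μ.bind ((Literature.MathematicalPhysics.KineticTheory.HeatConduction.pinnedChain ω₂ lam β γ).transitionKernel N T_L T_R t) = μ) → ∀ (z : Literature.MathematicalPhysics.KineticTheory.HeatConduction.PhaseSpace N) (t : NNReal) (f : Literature.MathematicalPhysics.KineticTheory.HeatConduction.PhaseSpace N → ℝ),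 Continuous f → (∀ y, |f y| ≤ Real.exp (θ * (Literature.MathematicalPhysics.KineticTheory.HeatConduction.pinnedChain ω₂ lam β γ).hamiltonian N y)) → |MeasureTheory.integral ((Literature.MathematicalPhysics.KineticTheory.HeatConduction.pinnedChain ω₂ lam β γ).transitionKernel N T_L T_R t z) (fun y => f y) - MeasureTheory.integral μ (fun y => f y)| ≤ C * Real.exp (θ * (Literature.MathematicalPhysics.KineticTheory.HeatConduction.pinnedChain ω₂ lam β γ).hamiltonian N z) * Real.exp (-c * (t : ℝ)) :=
  fun _ _ _ _ hω hl hβ hγ _ hN _ hθ _ _ _ ha0 ha1 hb hα _ hm _ hΛ =>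
    expConvergence_of_drift_of_minorization hω hl hβ hγ hN hθ ha0 ha1 hb hα hm hΛ

end Summit.AtomisticToContinuum.FouriersLaw.Theorems.FixedLengthNoiseContinuity

end
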